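import Mathlib
import Summits.Ventures.PercRepro2.V2SP
import Summits.Ventures.PercRepro2.Tail2DStochDom

/-!
# The block calculus: product couplings and mixtures of block dominations
(seat mine-b, cell pub-perc-repro2; conjectures/MINE-B.md §42)

A BLOCK of a network is a finite set of configurations; `BlockDom s A A'` says that the uniform measure on `A`
is stochastically dominated (configuration order `red < blue`) by the uniform measure on `A'`: for every monotone
weight `f`, `Σ_A f · #A' ≤ Σ_{A'} f · #A`.  (SD) at a clipped position is the block domination of two tail sets
(`sdomZ_iff_blockDom`).

Two closure rules make block dominations compose:
* **products** (`blockDom_prod_par`, `blockDom_prod_ser`): `A ≼ A'` and `B ≼ B'` give `A × B ≼ A' × B'` on a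
  parallel or series composition (the configuration order is the product order) — the product coupling;
* **mixtures** (`blockDom_of_mixture`): if the uniform measure on `E` is a non-negative combination
  `Σ_k w_k · Unif(P_k)` and the uniform measure on `E'` is `Σ_k w_k · Unif(Q_k)` with the same weights and
  `P_k ≼ Q_k` for every `k`, then `E ≼ E'`.

Together (`blockDom_par_of_certificate`, `blockDom_ser_of_certificate`): a domination on `X ∥ Y` (or `X ∧ Y`)
between two sets follows from a finite CERTIFICATE — product blocks `A_k × B_k → A'_k × B'_k` with weights `w_k`
whose source and target mixtures are the two uniform measures, and the factor dominations `A_k ≼ A'_k`,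
`B_k ≼ B'_k`.  The block LP of §42 searches such certificates over the dictionary {cells, tails, row-tails,
col-tails}; this file is the engine that turns a feasible plan into a proof.  Two first uses: the series step of
(SD) is the product coupling of the two tail sets (`sdomZ_ser_of_blockDom`), and the axis member `(0, c)` of (SD)
follows from the normalized-matching property of the ROWS `{b = c} ≼ {b = j}`, `j ≥ c + 1` (the window lemma
`blockDom_tail_zero_of_rows`, `sdomZ_zero_of_rows`; the rows are census-true on every pin-free SP network ≤ 9
edges, §42.1).
-/

namespace Summit.Ventures.PercRepro2.Tail2D

open V2Closure Finset

section BlockDom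

variable (s : V2Closure.SP)

/-- the `f`-mass of a block -/
def blockSum (A : Finset s.Conf) (f : s.Conf → ℕ) : ℕ := ∑ x ∈ A, f x

/-- **block domination** `Unif(A) ≼ Unif(A')`: for every monotone weight `f`, `Σ_A f · #A' ≤ Σ_{A'} f · #A` -/
def BlockDom (A A' : Finset s.Conf) : Prop :=
  ∀ f : s.Conf → ℕ, Monotone f → blockSum s A f * A'.card ≤ blockSum s A' f * A.card

/-- every block dominates itself -/
theorem blockDom_refl (A : Finset s.Conf) : BlockDom s A A := fun _ _ => le_rfl

/-- domination is transitive through a non-empty middle block -/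
theorem blockDom_trans {A B C : Finset s.Conf} (hB : B.Nonempty) (h1 : BlockDom s A B) (h2 : BlockDom s B C) :
    BlockDom s A C := by
  intro f hf
  have h1' := h1 f hf; have h2' := h2 f hf
  have hBpos : 0 < B.card := Finset.card_pos.2 hB
  have key : blockSum s A f * C.card * B.card ≤ blockSum s C f * A.card * B.card := by
    calc blockSum s A f * C.card * B.card = (blockSum s A f * B.card) * C.card := by ring
      _ ≤ (blockSum s B f * A.card) * C.card := Nat.mul_le_mul_right _ h1'
      _ = (blockSum s B f * C.card) * A.card := by ring
      _ ≤ (blockSum s C f * B.card) * A.card := Nat.mul_le_mul_right _ h2'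
      _ = blockSum s C f * A.card * B.card := by ring
  exact Nat.le_of_mul_le_mul_right key hBpos

/-- the tail sum is the block sum of the tail set -/
theorem tailSum_eq_blockSum (f : s.Conf → ℕ) (a c : ℕ) : tailSum s f a c = blockSum s (tailSet s a c) f := rfl

/-- **(SD) at a clipped position is the block domination of the two tail sets** -/
theorem sdomZ_iff_blockDom (u v : ℤ) :
    SDomZ s u v ↔ BlockDom s (tailSet s u.toNat v.toNat) (tailSet s (u - 1).toNat (v + 1).toNat) := by
  unfold SDomZ BlockDom
  simp only [tailSum_eq_blockSum, tailCount_eq_card]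

end BlockDom

section Product

variable (s t : V2Closure.SP)

/-- the configuration order of a parallel composition is the product order -/
theorem par_le_iff (p q : (V2Closure.SP.par s t).Conf) : p ≤ q ↔ p.1 ≤ q.1 ∧ p.2 ≤ q.2 := Iff.rfl

/-- the configuration order of a series composition is the product order -/
theorem ser_le_iff (p q : (V2Closure.SP.ser s t).Conf) : p ≤ q ↔ p.1 ≤ q.1 ∧ p.2 ≤ q.2 := Iff.rfl

/-- the block sum over a product block is an iterated sum -/
theorem blockSum_par_product (A : Finset s.Conf) (B : Finset t.Conf)
    (f : (V2Closure.SP.par s t).Conf → ℕ) :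
    blockSum (V2Closure.SP.par s t) (A ×ˢ B) f = ∑ x ∈ A, ∑ y ∈ B, f (x, y) := by
  unfold blockSum
  exact Finset.sum_product A B f

/-- the block sum over a product block is an iterated sum (series) -/
theorem blockSum_ser_product (A : Finset s.Conf) (B : Finset t.Conf)
    (f : (V2Closure.SP.ser s t).Conf → ℕ) :
    blockSum (V2Closure.SP.ser s t) (A ×ˢ B) f = ∑ x ∈ A, ∑ y ∈ B, f (x, y) := by
  unfold blockSum
  exact Finset.sum_product A B f

/-- the algebraic core of the product coupling: fibre-wise domination in the second factor, then domination of
the first factor on the summed fibre weights -/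
theorem prod_core (A A' : Finset s.Conf) (B B' : Finset t.Conf) (g : s.Conf → t.Conf → ℕ)
    (h1 : ∀ x, (∑ y ∈ B, g x y) * B'.card ≤ (∑ y ∈ B', g x y) * B.card)
    (h2 : (∑ x ∈ A, ∑ y ∈ B', g x y) * A'.card ≤ (∑ x ∈ A', ∑ y ∈ B', g x y) * A.card) :
    (∑ x ∈ A, ∑ y ∈ B, g x y) * (A'.card * B'.card) ≤ (∑ x ∈ A', ∑ y ∈ B', g x y) * (A.card * B.card) := by
  have hs : (∑ x ∈ A, ∑ y ∈ B, g x y) * B'.card ≤ (∑ x ∈ A, ∑ y ∈ B', g x y) * B.card := by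
    rw [Finset.sum_mul, Finset.sum_mul]
    exact Finset.sum_le_sum (fun x _ => h1 x)
  calc (∑ x ∈ A, ∑ y ∈ B, g x y) * (A'.card * B'.card)
      = ((∑ x ∈ A, ∑ y ∈ B, g x y) * B'.card) * A'.card := by ring
    _ ≤ ((∑ x ∈ A, ∑ y ∈ B', g x y) * B.card) * A'.card := Nat.mul_le_mul_right _ hs
    _ = ((∑ x ∈ A, ∑ y ∈ B', g x y) * A'.card) * B.card := by ring
    _ ≤ ((∑ x ∈ A', ∑ y ∈ B', g x y) * A.card) * B.card := Nat.mul_le_mul_right _ h2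
    _ = (∑ x ∈ A', ∑ y ∈ B', g x y) * (A.card * B.card) := by ring

/-- **the product coupling on a parallel composition**: `A ≼ A'` and `B ≼ B'` give `A × B ≼ A' × B'` -/
theorem blockDom_prod_par {A A' : Finset s.Conf} {B B' : Finset t.Conf}
    (hA : BlockDom s A A') (hB : BlockDom t B B') :
    BlockDom (V2Closure.SP.par s t) (A ×ˢ B) (A' ×ˢ B') := by
  intro f hf
  have hfy : ∀ x : s.Conf, Monotone (fun y : t.Conf => f (x, y)) := fun x y y' hyy' =>
    hf ((par_le_iff s t (x, y) (x, y')).2 ⟨le_rfl, hyy'⟩)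
  have hfx : Monotone (fun x : s.Conf => ∑ y ∈ B', f (x, y)) :=
    fun x x' hxx' => Finset.sum_le_sum (fun y _ => hf ((par_le_iff s t (x, y) (x', y)).2 ⟨hxx', le_rfl⟩))
  have key := prod_core s t A A' B B' (fun x y => f (x, y)) (fun x => hB _ (hfy x)) (hA _ hfx)
  rw [blockSum_par_product, blockSum_par_product]
  have e1 : (A ×ˢ B).card = A.card * B.card := Finset.card_product A B
  have e2 : (A' ×ˢ B').card = A'.card * B'.card := Finset.card_product A' B'
  show (∑ x ∈ A, ∑ y ∈ B, f (x, y)) * (A' ×ˢ B').card ≤ (∑ x ∈ A', ∑ y ∈ B', f (x, y)) * (A ×ˢ B).card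
  rw [e1, e2]; exact key

/-- **the product coupling on a series composition** -/
theorem blockDom_prod_ser {A A' : Finset s.Conf} {B B' : Finset t.Conf}
    (hA : BlockDom s A A') (hB : BlockDom t B B') :
    BlockDom (V2Closure.SP.ser s t) (A ×ˢ B) (A' ×ˢ B') := by
  intro f hf
  have hfy : ∀ x : s.Conf, Monotone (fun y : t.Conf => f (x, y)) := fun x y y' hyy' =>
    hf ((ser_le_iff s t (x, y) (x, y')).2 ⟨le_rfl, hyy'⟩)
  have hfx : Monotone (fun x : s.Conf => ∑ y ∈ B', f (x, y)) :=
    fun x x' hxx' => Finset.sum_le_sum (fun y _ => hf ((ser_le_iff s t (x, y) (x', y)).2 ⟨hxx', le_rfl⟩))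
  have key := prod_core s t A A' B B' (fun x y => f (x, y)) (fun x => hB _ (hfy x)) (hA _ hfx)
  rw [blockSum_ser_product, blockSum_ser_product]
  have e1 : (A ×ˢ B).card = A.card * B.card := Finset.card_product A B
  have e2 : (A' ×ˢ B').card = A'.card * B'.card := Finset.card_product A' B'
  show (∑ x ∈ A, ∑ y ∈ B, f (x, y)) * (A' ×ˢ B').card ≤ (∑ x ∈ A', ∑ y ∈ B', f (x, y)) * (A ×ˢ B).card
  rw [e1, e2]; exact key

end Product

section Mixture

variable (s : V2Closure.SP)

/-- the uniform density of a block (`0` on the empty block) -/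
def unifDens (A : Finset s.Conf) (x : s.Conf) : ℚ := if x ∈ A then ((A.card : ℚ))⁻¹ else 0

/-- integrating a weight against the uniform density gives the block average -/
theorem sum_unifDens_mul (A : Finset s.Conf) (f : s.Conf → ℕ) :
    ∑ x, unifDens s A x * (f x : ℚ) = (blockSum s A f : ℚ) / A.card := by
  unfold unifDens blockSum
  simp only [ite_mul, zero_mul]
  rw [Finset.sum_ite_mem, Finset.univ_inter, ← Finset.mul_sum]
  push_cast
  rw [div_eq_inv_mul]

/-- a block domination between non-empty blocks, in average form -/
theorem blockDom_avg {A A' : Finset s.Conf} (h : BlockDom s A A') (hA : A.Nonempty) (hA' : A'.Nonempty)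
    (f : s.Conf → ℕ) (hf : Monotone f) :
    (blockSum s A f : ℚ) / A.card ≤ (blockSum s A' f : ℚ) / A'.card := by
  have hc : (0 : ℚ) < A.card := by exact_mod_cast Finset.card_pos.2 hA
  have hc' : (0 : ℚ) < A'.card := by exact_mod_cast Finset.card_pos.2 hA'
  rw [div_le_div_iff₀ hc hc']
  exact_mod_cast h f hf

/-- **mixtures of block dominations**: if `Unif(E) = Σ_k w_k · Unif(P_k)` and `Unif(E') = Σ_k w_k · Unif(Q_k)`
pointwise, with `w_k ≥ 0`, `P_k ≼ Q_k` for every `k`, and `Q_k` non-empty whenever `w_k > 0` and `P_k` is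
non-empty, then `E ≼ E'` -/
theorem blockDom_of_mixture {ι : Type*} [Fintype ι] (P Q : ι → Finset s.Conf) (w : ι → ℚ)
    (hw : ∀ k, 0 ≤ w k) (hdom : ∀ k, BlockDom s (P k) (Q k))
    (hne : ∀ k, 0 < w k → (P k).Nonempty → (Q k).Nonempty) (E E' : Finset s.Conf)
    (hcov : ∀ x, ∑ k, w k * unifDens s (P k) x = unifDens s E x)
    (hcov' : ∀ x, ∑ k, w k * unifDens s (Q k) x = unifDens s E' x) :
    BlockDom s E E' := by
  intro f hf
  rcases E.eq_empty_or_nonempty with hE | hE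
  · subst hE; simp [blockSum]
  rcases E'.eq_empty_or_nonempty with hE' | hE'
  · subst hE'; simp
  -- the averages are the mixtures of the block averages
  have avgE : (blockSum s E f : ℚ) / E.card = ∑ k, w k * ((blockSum s (P k) f : ℚ) / (P k).card) := by
    rw [← sum_unifDens_mul]
    simp_rw [← sum_unifDens_mul, Finset.mul_sum, ← hcov, Finset.sum_mul]
    rw [Finset.sum_comm]
    refine Finset.sum_congr rfl (fun x _ => Finset.sum_congr rfl (fun k _ => by ring))
  have avgE' : (blockSum s E' f : ℚ) / E'.card = ∑ k, w k * ((blockSum s (Q k) f : ℚ) / (Q k).card) := by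
    rw [← sum_unifDens_mul]
    simp_rw [← sum_unifDens_mul, Finset.mul_sum, ← hcov', Finset.sum_mul]
    rw [Finset.sum_comm]
    refine Finset.sum_congr rfl (fun x _ => Finset.sum_congr rfl (fun k _ => by ring))
  have key : (blockSum s E f : ℚ) / E.card ≤ (blockSum s E' f : ℚ) / E'.card := by
    rw [avgE, avgE']
    refine Finset.sum_le_sum (fun k _ => ?_)
    rcases (hw k).lt_or_eq with hwk | hwk
    · refine mul_le_mul_of_nonneg_left ?_ (hw k)
      rcases (P k).eq_empty_or_nonempty with hP | hP
      · rw [hP]; simp only [blockSum, Finset.sum_empty, Nat.cast_zero, zero_div]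
        exact div_nonneg (by positivity) (by positivity)
      · exact blockDom_avg s (hdom k) hP (hne k hwk hP) f hf
    · rw [← hwk]; simp
  have hc : (0 : ℚ) < E.card := by exact_mod_cast Finset.card_pos.2 hE
  have hc' : (0 : ℚ) < E'.card := by exact_mod_cast Finset.card_pos.2 hE'
  rw [div_le_div_iff₀ hc hc'] at key
  exact_mod_cast key

end Mixture

section Certificate

variable (s t : V2Closure.SP)

/-- **a certificate on a parallel composition**: product blocks `A_k × B_k → A'_k × B'_k` with weights `w_k`
whose source mixture is `Unif(E)` and target mixture `Unif(E')`, and the factor dominations `A_k ≼ A'_k`,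
`B_k ≼ B'_k`, give `E ≼ E'` on `s ∥ t` -/
theorem blockDom_par_of_certificate {ι : Type*} [Fintype ι] (A A' : ι → Finset s.Conf) (B B' : ι → Finset t.Conf)
    (w : ι → ℚ) (hw : ∀ k, 0 ≤ w k) (hA : ∀ k, BlockDom s (A k) (A' k)) (hB : ∀ k, BlockDom t (B k) (B' k))
    (hne : ∀ k, 0 < w k → (A k ×ˢ B k).Nonempty → (A' k ×ˢ B' k).Nonempty)
    (E E' : Finset (V2Closure.SP.par s t).Conf)
    (hcov : ∀ p, ∑ k, w k * unifDens (V2Closure.SP.par s t) (A k ×ˢ B k) p = unifDens _ E p)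
    (hcov' : ∀ p, ∑ k, w k * unifDens (V2Closure.SP.par s t) (A' k ×ˢ B' k) p = unifDens _ E' p) :
    BlockDom (V2Closure.SP.par s t) E E' :=
  blockDom_of_mixture (V2Closure.SP.par s t) (fun k => A k ×ˢ B k) (fun k => A' k ×ˢ B' k) w hw
    (fun k => blockDom_prod_par s t (hA k) (hB k)) hne E E' hcov hcov'

/-- **a certificate on a series composition** -/
theorem blockDom_ser_of_certificate {ι : Type*} [Fintype ι] (A A' : ι → Finset s.Conf) (B B' : ι → Finset t.Conf)
    (w : ι → ℚ) (hw : ∀ k, 0 ≤ w k) (hA : ∀ k, BlockDom s (A k) (A' k)) (hB : ∀ k, BlockDom t (B k) (B' k))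
    (hne : ∀ k, 0 < w k → (A k ×ˢ B k).Nonempty → (A' k ×ˢ B' k).Nonempty)
    (E E' : Finset (V2Closure.SP.ser s t).Conf)
    (hcov : ∀ p, ∑ k, w k * unifDens (V2Closure.SP.ser s t) (A k ×ˢ B k) p = unifDens _ E p)
    (hcov' : ∀ p, ∑ k, w k * unifDens (V2Closure.SP.ser s t) (A' k ×ˢ B' k) p = unifDens _ E' p) :
    BlockDom (V2Closure.SP.ser s t) E E' :=
  blockDom_of_mixture (V2Closure.SP.ser s t) (fun k => A k ×ˢ B k) (fun k => A' k ×ˢ B' k) w hw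
    (fun k => blockDom_prod_ser s t (hA k) (hB k)) hne E E' hcov hcov'

end Certificate

section SeriesAgain

variable (s t : V2Closure.SP)

/-- membership in the tail set of a series composition, coordinatewise -/
theorem mem_tailSet_ser (a c : ℕ) (p : (V2Closure.SP.ser s t).Conf) :
    p ∈ tailSet (V2Closure.SP.ser s t) a c ↔ p.1 ∈ tailSet s a c ∧ p.2 ∈ tailSet t a c := by
  simp only [tailSet, Finset.mem_filter, Finset.mem_univ, true_and]
  show (a ≤ serR s.rLab t.rLab p ∧ c ≤ serB s.bLab t.bLab p) ↔ _
  simp only [serR, serB, le_min_iff]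
  tauto

/-- the tail set of a series composition is the product of the tail sets -/
theorem tailSet_ser_eq_product (a c : ℕ) :
    tailSet (V2Closure.SP.ser s t) a c = (tailSet s a c ×ˢ tailSet t a c : Finset (s.Conf × t.Conf)) := by
  apply Finset.ext
  intro p
  rw [mem_tailSet_ser]
  exact Finset.mem_product.symm

/-- **the series step of (SD) as a product coupling** (the engine reproduces `sdomZ_ser`) -/
theorem sdomZ_ser_of_blockDom (u v : ℤ) (hs : SDomZ s u v) (ht : SDomZ t u v) :
    SDomZ (V2Closure.SP.ser s t) u v := by
  rw [sdomZ_iff_blockDom] at hs ht ⊢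
  rw [tailSet_ser_eq_product, tailSet_ser_eq_product]
  exact blockDom_prod_ser s t hs ht

end SeriesAgain

section Rows

variable (s : V2Closure.SP)

/-- the row `{b = c}` of a network: the configurations with blue flow exactly `c` -/
def rowSet (c : ℕ) : Finset s.Conf := Finset.univ.filter (fun x : s.Conf => s.bLab x = c)

/-- the blue tail `{b ≥ c}` is the tail set at the clipped position `(0, c)` -/
theorem tailSet_zero_eq (c : ℕ) : tailSet s 0 c = Finset.univ.filter (fun x : s.Conf => c ≤ s.bLab x) := by
  unfold tailSet
  congr 1
  ext x
  simp

/-- the blue tail `{b ≥ c}` is the row `{b = c}` together with the blue tail `{b ≥ c + 1}` -/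
theorem blockSum_tail_zero_succ (f : s.Conf → ℕ) (c : ℕ) :
    blockSum s (tailSet s 0 c) f = blockSum s (rowSet s c) f + blockSum s (tailSet s 0 (c + 1)) f := by
  unfold blockSum rowSet
  rw [tailSet_zero_eq, tailSet_zero_eq, Finset.sum_filter, Finset.sum_filter, Finset.sum_filter,
    ← Finset.sum_add_distrib]
  refine Finset.sum_congr rfl (fun x _ => ?_)
  by_cases h : s.bLab x = c
  · simp [h]
  · by_cases h' : c ≤ s.bLab x
    · have : c + 1 ≤ s.bLab x := by omega
      simp [h, h', this]
    · have : ¬ c + 1 ≤ s.bLab x := by omega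
      simp [h, h', this]

/-- the blue tail `{b ≥ c + 1}` is the disjoint union of the rows `{b = j}`, `c + 1 ≤ j ≤ m`, once `m` exceeds
every blue flow -/
theorem blockSum_tail_eq_sum_rows (f : s.Conf → ℕ) (c m : ℕ) (hm : ∀ x : s.Conf, s.bLab x ≤ m) :
    blockSum s (tailSet s 0 (c + 1)) f = ∑ j ∈ Finset.Icc (c + 1) m, blockSum s (rowSet s j) f := by
  unfold blockSum rowSet
  rw [tailSet_zero_eq, Finset.sum_filter]
  simp_rw [Finset.sum_filter]
  rw [Finset.sum_comm]
  refine Finset.sum_congr rfl (fun x _ => ?_)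
  by_cases h : c + 1 ≤ s.bLab x
  · rw [if_pos h]
    rw [Finset.sum_ite_eq_of_mem (Finset.Icc (c + 1) m) (s.bLab x)]
    exact Finset.mem_Icc.2 ⟨h, hm x⟩
  · rw [if_neg h]
    refine (Finset.sum_eq_zero (fun j hj => ?_)).symm
    rw [if_neg]
    intro hjx
    exact h (hjx ▸ (Finset.mem_Icc.1 hj).1)

/-- **the window lemma**: if the row `{b = c}` is dominated by every higher row `{b = j}`, `j ≥ c + 1`, then the
blue tail `{b ≥ c}` is dominated by the blue tail `{b ≥ c + 1}` — the axis member of (SD) at `(0, c)` follows from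
the normalized-matching property of the rows -/
theorem blockDom_tail_zero_of_rows (c m : ℕ) (hm : ∀ x : s.Conf, s.bLab x ≤ m)
    (hrow : ∀ j, c + 1 ≤ j → j ≤ m → BlockDom s (rowSet s c) (rowSet s j)) :
    BlockDom s (tailSet s 0 c) (tailSet s 0 (c + 1)) := by
  intro f hf
  -- the row against the tail above it
  have key : blockSum s (rowSet s c) f * (tailSet s 0 (c + 1)).card
      ≤ blockSum s (tailSet s 0 (c + 1)) f * (rowSet s c).card := by
    have e1 := blockSum_tail_eq_sum_rows s f c m hm
    have e2 := blockSum_tail_eq_sum_rows s (fun _ => 1) c m hm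
    simp only [blockSum, Finset.sum_const, smul_eq_mul, mul_one] at e2
    rw [e1, e2, Finset.sum_mul, Finset.mul_sum]
    refine Finset.sum_le_sum (fun j hj => ?_)
    have := hrow j (Finset.mem_Icc.1 hj).1 (Finset.mem_Icc.1 hj).2 f hf
    unfold blockSum at this ⊢
    linarith
  have hc : (tailSet s 0 c).card = (rowSet s c).card + (tailSet s 0 (c + 1)).card := by
    have := blockSum_tail_zero_succ s (fun _ => 1) c
    simpa [blockSum] using this
  rw [blockSum_tail_zero_succ, hc]
  nlinarith [key]

/-- the axis member `(0, c)` of (SD), in the lane's clipped form, from the rows -/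
theorem sdomZ_zero_of_rows (c m : ℕ) (hm : ∀ x : s.Conf, s.bLab x ≤ m)
    (hrow : ∀ j, c + 1 ≤ j → j ≤ m → BlockDom s (rowSet s c) (rowSet s j)) : SDomZ s 0 c := by
  rw [sdomZ_iff_blockDom]
  have e1 : ((0 : ℤ) - 1).toNat = 0 := rfl
  have e2 : ((c : ℤ) + 1).toNat = c + 1 := by omega
  have e3 : ((c : ℤ)).toNat = c := by omega
  rw [e1, e2, e3]
  exact blockDom_tail_zero_of_rows s c m hm hrow

end Rows

end Summit.Ventures.PercRepro2.Tail2D
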